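import Summits.MatrixMultiplication.MatrixMultiplication.Theses.NOFWindowCapacity

/-!
# Route NOFWindowCapacity — `SingleBlockBound` (W1, one block)

Item stmt-MatrixMultiplication-7276.  If an alien-free box `(P, Q, R)` of the addition table of a
finite abelian group `G` (legs `s t u : Fin N → G`) contains the full block `A × M × C` of
matrix-multiplication triples, then `|A|·|M|·|C| ≤ |G|` (Cohn–Umans 2003, Lemma 3.1 form, no
injectivity hypothesis on the legs).

Proof: the map `(i, j, k) ↦ -s i + t j + u k` is injective on `A × M × C`.  A collision
`-s i + t j + u k = -s i' + t j' + u k'` says exactly that the box triple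
`a = (i', k') ∈ P`, `b = (i, j) ∈ Q`, `c = (j', k) ∈ R` lies on the group table
(`(t j - s i) + (u k - t j') = u k' - s i'`), so alien-freeness gives `i' = i`, `j = j'`, `k' = k`.
-/

-- `Summit.<Summit>.<Problem>` is the tree's mandated summit-side namespace; for this
-- single-conjunct summit the two coincide, so the file silences `dupNamespace`.
set_option linter.dupNamespace false

namespace Summit.MatrixMultiplication.MatrixMultiplication.Theorems

open Summit.MatrixMultiplication.MatrixMultiplication.Theses.NOFWindowCapacity

/-- **W1 / single block bound** (item stmt-MatrixMultiplication-7276, Cohn–Umans 2003 Lemma 3.1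
form): an alien-free box containing the full block `A × M × C` of matrix-multiplication triples
satisfies `|A|·|M|·|C| ≤ |G|`, because `(i, j, k) ↦ -s i + t j + u k` is injective on the block. -/
theorem singleBlockBound_proof :
    Summit.MatrixMultiplication.MatrixMultiplication.Theses.NOFWindowCapacity.SingleBlockBound := by
  unfold SingleBlockBound
  intro N G _ _ s t u P Q R A M C hAF hblock
  classical
  -- the Cohn–Umans map on triples
  set f : Fin N × Fin N × Fin N → G := fun x => -s x.1 + t x.2.1 + u x.2.2 with hf
  have hinj : Set.InjOn f ↑(A ×ˢ M ×ˢ C) := by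
    rintro ⟨i, j, k⟩ hx ⟨i', j', k'⟩ hx' hEq
    simp only [Finset.coe_product, Set.mem_prod, Finset.mem_coe] at hx hx'
    obtain ⟨hi, hj, hk⟩ := hx
    obtain ⟨hi', hj', hk'⟩ := hx'
    have haP : (i', k') ∈ P := (hblock i' hi' j hj k' hk').1
    have hbQ : (i, j) ∈ Q := (hblock i hi j hj k hk).2.1
    have hcR : (j', k) ∈ R := (hblock i hi j' hj' k hk).2.2
    have htable : (t (i, j).2 - s (i, j).1) + (u (j', k).2 - t (j', k).1)
        = u (i', k').2 - s (i', k').1 := by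
      simp only [hf] at hEq
      dsimp only
      have h1 : t j - s i + (u k - t j') = (-s i + t j + u k) - t j' := by abel
      rw [h1, hEq]
      abel
    obtain ⟨h1, h2, h3⟩ := hAF (i', k') haP (i, j) hbQ (j', k) hcR htable
    dsimp only at h1 h2 h3
    subst h1 h2 h3
    rfl
  have hcard : (A ×ˢ M ×ˢ C).card ≤ (Finset.univ : Finset G).card :=
    Finset.card_le_card_of_injOn f (fun x _ => Finset.mem_univ (f x)) hinj
  simpa [Finset.card_product, Finset.card_univ, mul_assoc] using hcard

end Summit.MatrixMultiplication.MatrixMultiplication.Theorems
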